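import Summits.Ventures.YMGap.RobustBall.TierTwoCellsSU2Var
import Summits.Ventures.YMGap.RobustBall.TierTwoCellsSU2Dim3
import Summits.Ventures.YMGap.RobustBall.StarWindowZdWRowsSU2
import Summits.Ventures.YMGap.RobustBall.MassiveOnBallZdW
import HarnessLib

/-!
# Venture YMGap, track ROBUST-BALL (Y2) — tier-2, `SU(2)`: EVERY DLR STATE IS MASSIVE on the `ℤ⁴` VARIANCE-FORM cells (1/16,.308) (1/10,.256)
# (1/8,.222) (1/6,.169) (1/5,.128), and the MASSIVE (Osterwalder–Seiler) CLAUSE on the `ℤ³` cells (1/4,.114) (3/10,.090) (2/5,.049) (1/2,.017)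

HONEST FRAMING. WHAT THIS IS: a venture file (cell `pub-ymgap`, track Y2 ROBUST-BALL, seat ds-2): one-line consequences of the window cells
`su2_starWindowBoundZdW_starVar_<cell>` (`TierTwoCellsSU2Var.lean`) and `su2_starWindowBoundZdW_dim3_star_<cell>` (`TierTwoCellsSU2Dim3.lean`) through
the massive bridge (`massive_of_starWindowBoundZdW` at `d = 4`, `massiveClause_of_starWindowBoundZdW` at every `d`; `MassiveOnBallZdW.lean`): for each
cell and EVERY member `W` of `MemBallZdW (1/100) (2ε) ε` (gauge-invariant summable perturbations of `SU(2)` Wilson of ARBITRARY range; tree coupling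
`β_W/2`) — on `ℤ⁴` DLR states exist and EVERY DLR state is an Osterwalder–Seiler MASSIVE STATE with exponentially decaying plaquette–plaquette
correlation function (`su2_massive_onBallZdW_starVar_<cell>` + `_allWeights`); on `ℤ³`, for every DLR state the truncated correlations of ALL bounded
measurable local observables decay exponentially at one rate (`su2_massiveClause_onBallZdW_dim3_star_<cell>`; `IsMassiveState` itself is a `d = 4`
predicate of the tree). WHAT THIS IS NOT: strong-coupling LATTICE statements; the rate is a door artefact; nothing about the continuum or the
Millennium problem.
-/

noncomputable section

open MeasureTheory ProbabilityTheory Function Finset Real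
open scoped NNReal
open Literature.Probability.LatticeModels
open Literature.MathematicalPhysics.QuantumLattice hiding torusNorm
open Literature.MathematicalPhysics.QuantumFieldTheory hiding ZdEdge
open Literature.Barriers.QuantumFields (IsMassiveState)
open Summit.Ventures.YMGap.DSWindowZd

namespace Summit.Ventures.YMGap.RobustBall

/-! ### `ℤ⁴`, variance form: every DLR state is massive -/

/-- **MASSIVE, variance form, cell `(1 / 16, 0.308)`**: for every member of `MemBallZdW (1/100) (77 / 125) (77 / 250)`, DLR states of
`(1 / 32)·S_W + W` exist and EVERY DLR state is massive with exponentially decaying plaquette–plaquette correlations; HYPOTHESIS-FREE.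
[folklore] -/
theorem su2_massive_onBallZdW_starVar_oneSixteenth :
    ∀ W : Potential (ZdEdge 4) (SUN 2), MemBallZdW (1 / 100) (77 / 125) (77 / 250) W →
      (perturbedGibbsMeasuresS (d := 4) (fundamentalRep (Fin 2)) (1 / 32) W).Nonempty ∧
        ∀ μ ∈ perturbedGibbsMeasuresS (d := 4) (fundamentalRep (Fin 2)) (1 / 32) W,
          IsMassiveState μ ∧ HasExponentialDecay (plaquetteCorrFn (fundamentalRep (Fin 2)) μ) := by
  intro W hW
  have e : ((2 : ℕ) : ℝ) * ((1 / 16 : ℝ) / 4) = 1 / 32 := by norm_num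
  have h := massive_of_starWindowBoundZdW (N := 2) (by norm_num) hW (t := 1 / 1000000) (by norm_num) (by norm_num)
    (by norm_num) (by norm_num) starReach_nonneg (fun s x hx y => norm_sub_le_starReach s hx y)
    (su2_starWindowBoundZdW_starVar_oneSixteenth W hW)
  rwa [e] at h

/-- The variance-form massive cell at EVERY weight `κ ≥ 1/100`. [folklore] -/
theorem su2_massive_onBallZdW_starVar_oneSixteenth_allWeights {κ : ℝ} (hκ : 1 / 100 ≤ κ) :
    ∀ W : Potential (ZdEdge 4) (SUN 2), MemBallZdW κ (77 / 125) (77 / 250) W →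
      (perturbedGibbsMeasuresS (d := 4) (fundamentalRep (Fin 2)) (1 / 32) W).Nonempty ∧
        ∀ μ ∈ perturbedGibbsMeasuresS (d := 4) (fundamentalRep (Fin 2)) (1 / 32) W,
          IsMassiveState μ ∧ HasExponentialDecay (plaquetteCorrFn (fundamentalRep (Fin 2)) μ) := fun W hW =>
  su2_massive_onBallZdW_starVar_oneSixteenth W (hW.of_weight_le hκ)

/-- **MASSIVE, variance form, cell `(1 / 10, 0.256)`**: for every member of `MemBallZdW (1/100) (64 / 125) (32 / 125)`, DLR states of
`(1 / 20)·S_W + W` exist and EVERY DLR state is massive with exponentially decaying plaquette–plaquette correlations; HYPOTHESIS-FREE.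
[folklore] -/
theorem su2_massive_onBallZdW_starVar_oneTenth :
    ∀ W : Potential (ZdEdge 4) (SUN 2), MemBallZdW (1 / 100) (64 / 125) (32 / 125) W →
      (perturbedGibbsMeasuresS (d := 4) (fundamentalRep (Fin 2)) (1 / 20) W).Nonempty ∧
        ∀ μ ∈ perturbedGibbsMeasuresS (d := 4) (fundamentalRep (Fin 2)) (1 / 20) W,
          IsMassiveState μ ∧ HasExponentialDecay (plaquetteCorrFn (fundamentalRep (Fin 2)) μ) := by
  intro W hW
  have e : ((2 : ℕ) : ℝ) * ((1 / 10 : ℝ) / 4) = 1 / 20 := by norm_num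
  have h := massive_of_starWindowBoundZdW (N := 2) (by norm_num) hW (t := 1 / 1000000) (by norm_num) (by norm_num)
    (by norm_num) (by norm_num) starReach_nonneg (fun s x hx y => norm_sub_le_starReach s hx y)
    (su2_starWindowBoundZdW_starVar_oneTenth W hW)
  rwa [e] at h

/-- The variance-form massive cell at EVERY weight `κ ≥ 1/100`. [folklore] -/
theorem su2_massive_onBallZdW_starVar_oneTenth_allWeights {κ : ℝ} (hκ : 1 / 100 ≤ κ) :
    ∀ W : Potential (ZdEdge 4) (SUN 2), MemBallZdW κ (64 / 125) (32 / 125) W →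
      (perturbedGibbsMeasuresS (d := 4) (fundamentalRep (Fin 2)) (1 / 20) W).Nonempty ∧
        ∀ μ ∈ perturbedGibbsMeasuresS (d := 4) (fundamentalRep (Fin 2)) (1 / 20) W,
          IsMassiveState μ ∧ HasExponentialDecay (plaquetteCorrFn (fundamentalRep (Fin 2)) μ) := fun W hW =>
  su2_massive_onBallZdW_starVar_oneTenth W (hW.of_weight_le hκ)

/-- **MASSIVE, variance form, cell `(1 / 8, 0.222)`**: for every member of `MemBallZdW (1/100) (111 / 250) (111 / 500)`, DLR states of
`(1 / 16)·S_W + W` exist and EVERY DLR state is massive with exponentially decaying plaquette–plaquette correlations; HYPOTHESIS-FREE.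
[folklore] -/
theorem su2_massive_onBallZdW_starVar_oneEighth :
    ∀ W : Potential (ZdEdge 4) (SUN 2), MemBallZdW (1 / 100) (111 / 250) (111 / 500) W →
      (perturbedGibbsMeasuresS (d := 4) (fundamentalRep (Fin 2)) (1 / 16) W).Nonempty ∧
        ∀ μ ∈ perturbedGibbsMeasuresS (d := 4) (fundamentalRep (Fin 2)) (1 / 16) W,
          IsMassiveState μ ∧ HasExponentialDecay (plaquetteCorrFn (fundamentalRep (Fin 2)) μ) := by
  intro W hW
  have e : ((2 : ℕ) : ℝ) * ((1 / 8 : ℝ) / 4) = 1 / 16 := by norm_num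
  have h := massive_of_starWindowBoundZdW (N := 2) (by norm_num) hW (t := 1 / 1000000) (by norm_num) (by norm_num)
    (by norm_num) (by norm_num) starReach_nonneg (fun s x hx y => norm_sub_le_starReach s hx y)
    (su2_starWindowBoundZdW_starVar_oneEighth W hW)
  rwa [e] at h

/-- The variance-form massive cell at EVERY weight `κ ≥ 1/100`. [folklore] -/
theorem su2_massive_onBallZdW_starVar_oneEighth_allWeights {κ : ℝ} (hκ : 1 / 100 ≤ κ) :
    ∀ W : Potential (ZdEdge 4) (SUN 2), MemBallZdW κ (111 / 250) (111 / 500) W →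
      (perturbedGibbsMeasuresS (d := 4) (fundamentalRep (Fin 2)) (1 / 16) W).Nonempty ∧
        ∀ μ ∈ perturbedGibbsMeasuresS (d := 4) (fundamentalRep (Fin 2)) (1 / 16) W,
          IsMassiveState μ ∧ HasExponentialDecay (plaquetteCorrFn (fundamentalRep (Fin 2)) μ) := fun W hW =>
  su2_massive_onBallZdW_starVar_oneEighth W (hW.of_weight_le hκ)

/-- **MASSIVE, variance form, cell `(1 / 6, 0.169)`**: for every member of `MemBallZdW (1/100) (169 / 500) (169 / 1000)`, DLR states of
`(1 / 12)·S_W + W` exist and EVERY DLR state is massive with exponentially decaying plaquette–plaquette correlations; HYPOTHESIS-FREE.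
[folklore] -/
theorem su2_massive_onBallZdW_starVar_oneSixth :
    ∀ W : Potential (ZdEdge 4) (SUN 2), MemBallZdW (1 / 100) (169 / 500) (169 / 1000) W →
      (perturbedGibbsMeasuresS (d := 4) (fundamentalRep (Fin 2)) (1 / 12) W).Nonempty ∧
        ∀ μ ∈ perturbedGibbsMeasuresS (d := 4) (fundamentalRep (Fin 2)) (1 / 12) W,
          IsMassiveState μ ∧ HasExponentialDecay (plaquetteCorrFn (fundamentalRep (Fin 2)) μ) := by
  intro W hW
  have e : ((2 : ℕ) : ℝ) * ((1 / 6 : ℝ) / 4) = 1 / 12 := by norm_num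
  have h := massive_of_starWindowBoundZdW (N := 2) (by norm_num) hW (t := 1 / 1000000) (by norm_num) (by norm_num)
    (by norm_num) (by norm_num) starReach_nonneg (fun s x hx y => norm_sub_le_starReach s hx y)
    (su2_starWindowBoundZdW_starVar_oneSixth W hW)
  rwa [e] at h

/-- The variance-form massive cell at EVERY weight `κ ≥ 1/100`. [folklore] -/
theorem su2_massive_onBallZdW_starVar_oneSixth_allWeights {κ : ℝ} (hκ : 1 / 100 ≤ κ) :
    ∀ W : Potential (ZdEdge 4) (SUN 2), MemBallZdW κ (169 / 500) (169 / 1000) W →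
      (perturbedGibbsMeasuresS (d := 4) (fundamentalRep (Fin 2)) (1 / 12) W).Nonempty ∧
        ∀ μ ∈ perturbedGibbsMeasuresS (d := 4) (fundamentalRep (Fin 2)) (1 / 12) W,
          IsMassiveState μ ∧ HasExponentialDecay (plaquetteCorrFn (fundamentalRep (Fin 2)) μ) := fun W hW =>
  su2_massive_onBallZdW_starVar_oneSixth W (hW.of_weight_le hκ)

/-- **MASSIVE, variance form, cell `(1 / 5, 0.128)`**: for every member of `MemBallZdW (1/100) (32 / 125) (16 / 125)`, DLR states of
`(1 / 10)·S_W + W` exist and EVERY DLR state is massive with exponentially decaying plaquette–plaquette correlations; HYPOTHESIS-FREE.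
[folklore] -/
theorem su2_massive_onBallZdW_starVar_oneFifth :
    ∀ W : Potential (ZdEdge 4) (SUN 2), MemBallZdW (1 / 100) (32 / 125) (16 / 125) W →
      (perturbedGibbsMeasuresS (d := 4) (fundamentalRep (Fin 2)) (1 / 10) W).Nonempty ∧
        ∀ μ ∈ perturbedGibbsMeasuresS (d := 4) (fundamentalRep (Fin 2)) (1 / 10) W,
          IsMassiveState μ ∧ HasExponentialDecay (plaquetteCorrFn (fundamentalRep (Fin 2)) μ) := by
  intro W hW
  have e : ((2 : ℕ) : ℝ) * ((1 / 5 : ℝ) / 4) = 1 / 10 := by norm_num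
  have h := massive_of_starWindowBoundZdW (N := 2) (by norm_num) hW (t := 1 / 1000000) (by norm_num) (by norm_num)
    (by norm_num) (by norm_num) starReach_nonneg (fun s x hx y => norm_sub_le_starReach s hx y)
    (su2_starWindowBoundZdW_starVar_oneFifth W hW)
  rwa [e] at h

/-- The variance-form massive cell at EVERY weight `κ ≥ 1/100`. [folklore] -/
theorem su2_massive_onBallZdW_starVar_oneFifth_allWeights {κ : ℝ} (hκ : 1 / 100 ≤ κ) :
    ∀ W : Potential (ZdEdge 4) (SUN 2), MemBallZdW κ (32 / 125) (16 / 125) W →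
      (perturbedGibbsMeasuresS (d := 4) (fundamentalRep (Fin 2)) (1 / 10) W).Nonempty ∧
        ∀ μ ∈ perturbedGibbsMeasuresS (d := 4) (fundamentalRep (Fin 2)) (1 / 10) W,
          IsMassiveState μ ∧ HasExponentialDecay (plaquetteCorrFn (fundamentalRep (Fin 2)) μ) := fun W hW =>
  su2_massive_onBallZdW_starVar_oneFifth W (hW.of_weight_le hκ)

/-! ### `ℤ³`: the massive clause for every DLR state -/

/-- **`ℤ³` MASSIVE CLAUSE, cell `(1 / 4, 0.114)`**: for every member of `MemBallZdW (1/100) (57 / 250) (57 / 500)` and every DLR state of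
`(1 / 8)·S_W + W` on `ℤ³`, the truncated correlations of ALL bounded measurable local observables decay exponentially at one rate;
HYPOTHESIS-FREE. [folklore] -/
theorem su2_massiveClause_onBallZdW_dim3_star_oneQuarter :
    ∀ W : Potential (ZdEdge 3) (SUN 2), MemBallZdW (1 / 100) (57 / 250) (57 / 500) W →
      ∀ μ ∈ perturbedGibbsMeasuresS (d := 3) (fundamentalRep (Fin 2)) (1 / 8) W,
        ∃ m : ℝ, ∀ F₁ F₂ : LGConfig 3 (SUN 2) → ℝ,
          Literature.MathematicalPhysics.QuantumLattice.IsLocalObservable F₁ →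
          Literature.MathematicalPhysics.QuantumLattice.IsLocalObservable F₂ →
          Measurable F₁ → Measurable F₂ → (∃ C, ∀ U, |F₁ U| ≤ C) → (∃ C, ∀ U, |F₂ U| ≤ C) →
            HasExponentialDecayRate
              (fun x : Site 3 => cov[F₁, fun U => F₂ (Literature.MathematicalPhysics.QuantumLattice.configShift x U); μ]) m := by
  intro W hW
  have e : ((2 : ℕ) : ℝ) * ((1 / 4 : ℝ) / 4) = 1 / 8 := by norm_num
  have h := massiveClause_of_starWindowBoundZdW (d := 3) (N := 2) (by norm_num) (by norm_num) hW (t := 1 / 1000000)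
    (by norm_num) (by norm_num) (by norm_num) (by norm_num) starReach_nonneg (fun s x hx y => norm_sub_le_starReach s hx y)
    (su2_starWindowBoundZdW_dim3_star_oneQuarter W hW)
  rwa [e] at h

/-- **`ℤ³` MASSIVE CLAUSE, cell `(3 / 10, 0.090)`**: for every member of `MemBallZdW (1/100) (9 / 50) (9 / 100)` and every DLR state of
`(3 / 20)·S_W + W` on `ℤ³`, the truncated correlations of ALL bounded measurable local observables decay exponentially at one rate;
HYPOTHESIS-FREE. [folklore] -/
theorem su2_massiveClause_onBallZdW_dim3_star_threeTenths :
    ∀ W : Potential (ZdEdge 3) (SUN 2), MemBallZdW (1 / 100) (9 / 50) (9 / 100) W →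
      ∀ μ ∈ perturbedGibbsMeasuresS (d := 3) (fundamentalRep (Fin 2)) (3 / 20) W,
        ∃ m : ℝ, ∀ F₁ F₂ : LGConfig 3 (SUN 2) → ℝ,
          Literature.MathematicalPhysics.QuantumLattice.IsLocalObservable F₁ →
          Literature.MathematicalPhysics.QuantumLattice.IsLocalObservable F₂ →
          Measurable F₁ → Measurable F₂ → (∃ C, ∀ U, |F₁ U| ≤ C) → (∃ C, ∀ U, |F₂ U| ≤ C) →
            HasExponentialDecayRate
              (fun x : Site 3 => cov[F₁, fun U => F₂ (Literature.MathematicalPhysics.QuantumLattice.configShift x U); μ]) m := by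
  intro W hW
  have e : ((2 : ℕ) : ℝ) * ((3 / 10 : ℝ) / 4) = 3 / 20 := by norm_num
  have h := massiveClause_of_starWindowBoundZdW (d := 3) (N := 2) (by norm_num) (by norm_num) hW (t := 1 / 1000000)
    (by norm_num) (by norm_num) (by norm_num) (by norm_num) starReach_nonneg (fun s x hx y => norm_sub_le_starReach s hx y)
    (su2_starWindowBoundZdW_dim3_star_threeTenths W hW)
  rwa [e] at h

/-- **`ℤ³` MASSIVE CLAUSE, cell `(2 / 5, 0.049)`**: for every member of `MemBallZdW (1/100) (49 / 500) (49 / 1000)` and every DLR state of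
`(1 / 5)·S_W + W` on `ℤ³`, the truncated correlations of ALL bounded measurable local observables decay exponentially at one rate;
HYPOTHESIS-FREE. [folklore] -/
theorem su2_massiveClause_onBallZdW_dim3_star_twoFifths :
    ∀ W : Potential (ZdEdge 3) (SUN 2), MemBallZdW (1 / 100) (49 / 500) (49 / 1000) W →
      ∀ μ ∈ perturbedGibbsMeasuresS (d := 3) (fundamentalRep (Fin 2)) (1 / 5) W,
        ∃ m : ℝ, ∀ F₁ F₂ : LGConfig 3 (SUN 2) → ℝ,
          Literature.MathematicalPhysics.QuantumLattice.IsLocalObservable F₁ →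
          Literature.MathematicalPhysics.QuantumLattice.IsLocalObservable F₂ →
          Measurable F₁ → Measurable F₂ → (∃ C, ∀ U, |F₁ U| ≤ C) → (∃ C, ∀ U, |F₂ U| ≤ C) →
            HasExponentialDecayRate
              (fun x : Site 3 => cov[F₁, fun U => F₂ (Literature.MathematicalPhysics.QuantumLattice.configShift x U); μ]) m := by
  intro W hW
  have e : ((2 : ℕ) : ℝ) * ((2 / 5 : ℝ) / 4) = 1 / 5 := by norm_num
  have h := massiveClause_of_starWindowBoundZdW (d := 3) (N := 2) (by norm_num) (by norm_num) hW (t := 1 / 1000000)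
    (by norm_num) (by norm_num) (by norm_num) (by norm_num) starReach_nonneg (fun s x hx y => norm_sub_le_starReach s hx y)
    (su2_starWindowBoundZdW_dim3_star_twoFifths W hW)
  rwa [e] at h

/-- **`ℤ³` MASSIVE CLAUSE, cell `(1 / 2, 0.017)`**: for every member of `MemBallZdW (1/100) (17 / 500) (17 / 1000)` and every DLR state of
`(1 / 4)·S_W + W` on `ℤ³`, the truncated correlations of ALL bounded measurable local observables decay exponentially at one rate;
HYPOTHESIS-FREE. [folklore] -/
theorem su2_massiveClause_onBallZdW_dim3_star_oneHalf :
    ∀ W : Potential (ZdEdge 3) (SUN 2), MemBallZdW (1 / 100) (17 / 500) (17 / 1000) W →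
      ∀ μ ∈ perturbedGibbsMeasuresS (d := 3) (fundamentalRep (Fin 2)) (1 / 4) W,
        ∃ m : ℝ, ∀ F₁ F₂ : LGConfig 3 (SUN 2) → ℝ,
          Literature.MathematicalPhysics.QuantumLattice.IsLocalObservable F₁ →
          Literature.MathematicalPhysics.QuantumLattice.IsLocalObservable F₂ →
          Measurable F₁ → Measurable F₂ → (∃ C, ∀ U, |F₁ U| ≤ C) → (∃ C, ∀ U, |F₂ U| ≤ C) →
            HasExponentialDecayRate
              (fun x : Site 3 => cov[F₁, fun U => F₂ (Literature.MathematicalPhysics.QuantumLattice.configShift x U); μ]) m := by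
  intro W hW
  have e : ((2 : ℕ) : ℝ) * ((1 / 2 : ℝ) / 4) = 1 / 4 := by norm_num
  have h := massiveClause_of_starWindowBoundZdW (d := 3) (N := 2) (by norm_num) (by norm_num) hW (t := 1 / 1000000)
    (by norm_num) (by norm_num) (by norm_num) (by norm_num) starReach_nonneg (fun s x hx y => norm_sub_le_starReach s hx y)
    (su2_starWindowBoundZdW_dim3_star_oneHalf W hW)
  rwa [e] at h

end Summit.Ventures.YMGap.RobustBall

end
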